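import Mathlib.Algebra.Group.Submonoid.Basic
import Mathlib.Order.ConditionallyCompleteLattice.Basic
import Literature.Computability.Cryptography.QubitRegister
import HarnessLib

/-!
# Stabilizer states, stabilizer rank and approximate stabilizer rank

Trunk T-CPLX-QUANT (Literature/Computability/QuantumComplexity); definition request
`defn-approxStabilizerRank` (route QuantumAdvantage/Dequantize, cruxes #2, #5).

Over the tree's qubit registers `QReg n → ℂ` (`QubitRegister.lean`):

* `clifford` — the Clifford gate set `{H, S, CNOT}` (the tree's `cliffordT` without `T`);
* `stabilizerStates n` — the `n`-qubit stabilizer states: `C |0ⁿ⟩` for `C` in the monoid generated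
  by placements of Clifford gates on `n` wires (Aaronson–Gottesman: stabilizer states are exactly
  the Clifford orbit of `|0ⁿ⟩`; the set is closed under the global phases `ω^k`, `ω = e^{iπ/4}`,
  generated by `(SH)³ = ω 1`, which is immaterial for ranks);
* `stabilizerRank ψ = χ(ψ)` — the least `r` such that `ψ` is a linear combination of `r`
  stabilizer states (Bravyi–Smith–Smolin 2016 / Bravyi–Gosset 2016);
* `approxStabilizerRank δ ψ = χ_δ(ψ)` — the least stabilizer rank of a `φ` with `‖ψ - φ‖ ≤ δ`
  (Bravyi–Browne–Calpin–Campbell–Gosset–Howard 2019, §2), with `‖·‖²` the tree's `normSq`;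
* `magicT = T H |0⟩ = (|0⟩ + e^{iπ/4} |1⟩)/√2` and its tensor powers `tensorPow magicT m`
  (the resource states whose (approximate) stabilizer rank governs Clifford+T simulation cost).

## Sources

* S. Bravyi, D. Gosset, *Improved classical simulation of quantum circuits dominated by Clifford
  gates*, PRL 116 (2016) 250501 (stabilizer rank `χ`, magic states `|H⟩^{⊗m}`/`|T⟩`-type).
* S. Bravyi, D. Browne, P. Calpin, E. Campbell, D. Gosset, M. Howard, *Simulation of quantum
  circuits by low-rank stabilizer decompositions*, Quantum 3 (2019) 181, §2 (exact and
  approximate stabilizer rank `χ_δ`).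
* S. Peleg, A. Shpilka, B. L. Volk, *Lower bounds on stabilizer rank*, Quantum 6 (2022) 652, §1.
* S. Aaronson, D. Gottesman, *Improved simulation of stabilizer circuits*, PRA 70 (2004) 052328
  (stabilizer states = Clifford circuits on `|0ⁿ⟩`).

## Design choices

* Stabilizer states are defined operationally (Clifford orbit of `|0ⁿ⟩`) rather than via Pauli
  stabilizer groups; the equivalence is Aaronson–Gottesman's and is not needed here.
* Ranks are `ℕ`-valued `sInf`s over nonempty sets in the intended cases (every vector is a
  combination of `≤ 2ⁿ` computational basis states, which are stabilizer states — a fact not proved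
  here); formally `sInf ∅ = 0` would be the junk value. `stabilizerRank 0 = 0` genuinely (empty
  sum).
* `approxStabilizerRank δ ψ` uses `normSq (ψ - φ) ≤ δ ^ 2` (requester's form of `‖ψ - φ‖ ≤ δ`);
  Bravyi et al. state it for unit `ψ`, which is not imposed in the definition.
* Mathlib: `Submonoid.closure`, `Matrix.mulVec`, `sInf` on `ℕ`; no stabilizer formalism exists in
  Mathlib or the tree (searched `stabilizer`, `Clifford` in Literature/Computability).
-/

noncomputable section

open Matrix

namespace Literature.Computability.QuantumComplexity

/-! ### The Clifford gate set and stabilizer states -/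

/-- The gate symbols of the Clifford gate set `{H, S, CNOT}`. [Aaronson–Gottesman 2004, §I;
Bravyi–Gosset 2016] [cite: AaronsonGottesman2004, §I] -/
inductive CliffordOp
  | H
  | S
  | CNOT
  deriving DecidableEq, Fintype, Inhabited

/-- The Clifford gate set `{H, S, CNOT}` (arities `1, 1, 2`), generating the Clifford group modulo
phases; the tree's `cliffordT` minus the `T` gate. [Aaronson–Gottesman 2004, §I;
Nielsen–Chuang §10.5.2] [cite: AaronsonGottesman2004, §I] -/
def clifford : Cryptography.QGateSet where
  Op := CliffordOp
  arity
    | .H => 1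
    | .S => 1
    | .CNOT => 2
  mat
    | .H => Cryptography.hGate
    | .S => Cryptography.sGate
    | .CNOT => Cryptography.cnot

/-- The monoid of `n`-qubit Clifford circuits: products of placements of `H`, `S`, `CNOT` on `n`
wires (Mathlib `Submonoid.closure` of `placements clifford n`). [Aaronson–Gottesman 2004, §I] [cite: AaronsonGottesman2004, §I] -/
def cliffordCircuits (n : ℕ) : Submonoid (Matrix (Cryptography.QReg n) (Cryptography.QReg n) ℂ) :=
  Submonoid.closure (Cryptography.placements clifford n)

/-- The `n`-qubit **stabilizer states**: `C |0ⁿ⟩` for a Clifford circuit `C` (closed under the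
global phases `e^{iπk/4}` generated by `(SH)³`). [Aaronson–Gottesman 2004, Thm. 1 (stabilizer
states = Clifford circuits applied to `|0ⁿ⟩`); Bravyi–Gosset 2016] [cite: AaronsonGottesman2004, Thm. 1] -/
def stabilizerStates (n : ℕ) : Set (Cryptography.QReg n → ℂ) :=
  {ψ | ∃ C ∈ cliffordCircuits n, ψ = C.mulVec (Cryptography.zeroState n)}

/-! ### Stabilizer rank, exact and approximate -/

/-- The **stabilizer rank** `χ(ψ)`: the least `r` such that `ψ = ∑_{i<r} cᵢ φᵢ` with complex
coefficients `cᵢ` and stabilizer states `φᵢ`. [Bravyi–Gosset 2016 (definition of `χ`);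
Bravyi et al. 2019, §2; Peleg–Shpilka–Volk 2022, §1] [cite: BravyiGosset2016, eq. (1)] -/
def stabilizerRank {n : ℕ} (ψ : Cryptography.QReg n → ℂ) : ℕ :=
  sInf {r | ∃ (c : Fin r → ℂ) (φ : Fin r → Cryptography.QReg n → ℂ),
    (∀ i, φ i ∈ stabilizerStates n) ∧ ψ = ∑ i, c i • φ i}

/-- The **`δ`-approximate stabilizer rank** `χ_δ(ψ)`: the least stabilizer rank of a state `φ`
with `‖ψ - φ‖ ≤ δ` (here `normSq (ψ - φ) ≤ δ²`). [Bravyi–Browne–Calpin–Campbell–Gosset–Howard 2019,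
§2 (approximate stabilizer rank)] [cite: BravyiEtAl2019, §2] -/
def approxStabilizerRank {n : ℕ} (δ : ℝ) (ψ : Cryptography.QReg n → ℂ) : ℕ :=
  sInf {r | ∃ φ : Cryptography.QReg n → ℂ, Cryptography.normSq (ψ - φ) ≤ δ ^ 2 ∧ stabilizerRank φ = r}

/-! ### Magic states -/

/-- The single-qubit magic state `|T⟩ = T H |0⟩ = (|0⟩ + e^{iπ/4} |1⟩)/√2` (often written `|A⟩` or
`|H⟩` up to Clifford equivalence). [Bravyi–Gosset 2016 (magic state for `T` gadgets);
Bravyi et al. 2019, §2] [cite: BravyiGosset2016, eq. (2)] -/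
def magicT : Cryptography.QReg 1 → ℂ :=
  Cryptography.tGate.mulVec (Cryptography.hGate.mulVec (Cryptography.zeroState 1))

/-- Tensor powers `ψ^{⊗m}` of a single-qubit state, via the tree's `tensorVec`
(`ψ^{⊗0}` is the scalar `1` on zero qubits). [Bravyi–Gosset 2016 (`|A⟩^{⊗t}`)] [folklore] -/
def tensorPow (ψ : Cryptography.QReg 1 → ℂ) : (m : ℕ) → Cryptography.QReg m → ℂ
  | 0 => fun _ => 1
  | m + 1 => Cryptography.tensorVec (tensorPow ψ m) ψ

/-! ### API -/

/-- `|0ⁿ⟩` is a stabilizer state (empty circuit). [Aaronson–Gottesman 2004, §I] [folklore] -/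
theorem zeroState_mem_stabilizerStates (n : ℕ) : Cryptography.zeroState n ∈ stabilizerStates n :=
  ⟨1, Submonoid.one_mem _, by simp⟩

/-- Stabilizer states are closed under Clifford circuits. [Aaronson–Gottesman 2004, §I] [folklore] -/
theorem mulVec_mem_stabilizerStates {n : ℕ} {C : Matrix (Cryptography.QReg n) (Cryptography.QReg n) ℂ}
    (hC : C ∈ cliffordCircuits n) {ψ : Cryptography.QReg n → ℂ} (hψ : ψ ∈ stabilizerStates n) :
    C.mulVec ψ ∈ stabilizerStates n := by
  obtain ⟨D, hD, rfl⟩ := hψ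
  exact ⟨C * D, Submonoid.mul_mem _ hC hD, by simp [Matrix.mulVec_mulVec]⟩

/-- A stabilizer state has stabilizer rank at most `1`. [Bravyi–Gosset 2016] [folklore] -/
theorem stabilizerRank_le_one_of_mem {n : ℕ} {ψ : Cryptography.QReg n → ℂ} (h : ψ ∈ stabilizerStates n) :
    stabilizerRank ψ ≤ 1 :=
  Nat.sInf_le ⟨fun _ => 1, fun _ => ψ, fun _ => h, by simp⟩

/-- The zero vector has stabilizer rank `0` (empty decomposition). [Bravyi et al. 2019, §2] [folklore] -/
@[simp] theorem stabilizerRank_zero (n : ℕ) : stabilizerRank (0 : Cryptography.QReg n → ℂ) = 0 :=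
  Nat.eq_zero_of_le_zero (Nat.sInf_le ⟨Fin.elim0, Fin.elim0, fun i => i.elim0, by simp⟩)

/-- The approximate rank is at most the exact rank (take `φ = ψ`), for any `δ`.
[Bravyi et al. 2019, §2 (`χ_δ ≤ χ`)] [folklore] -/
theorem approxStabilizerRank_le_stabilizerRank {n : ℕ} (δ : ℝ) (ψ : Cryptography.QReg n → ℂ) :
    approxStabilizerRank δ ψ ≤ stabilizerRank ψ :=
  Nat.sInf_le ⟨ψ, by simp [Cryptography.normSq, sq_nonneg], rfl⟩

/-- `tensorPow ψ 1` is `ψ` (on the single wire). [folklore] -/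
theorem tensorPow_one (ψ : Cryptography.QReg 1 → ℂ) (z : Cryptography.QReg 1) : tensorPow ψ 1 z = ψ z := by
  simp only [tensorPow, Cryptography.tensorVec, one_mul]
  congr 1
  funext j
  fin_cases j
  rfl

end Literature.Computability.QuantumComplexity
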